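import Literature.NumberTheory.EllipticCurves.ModularParamYRationality
import Literature.NumberTheory.EllipticCurves.FormalGroupLogHomProofs
import Literature.NumberTheory.EllipticCurves.FormalGroupHasseInvariantProofs
import HarnessLib

/-!
# The formal logarithm of `E_f` along the modular parametrisation: `log_E(z(q)) = Σ aₙqⁿ/n`

Topic `NumberTheory/EllipticCurves`; a proofs-only file (theorems only, no definitions, no named
facts). Let `f ∈ S₂(Γ₀(N))`, `f ≠ 0`, `u = 2πi∫_{i∞} f = Σ aₙqⁿ/n` its Eichler integral,
`Λ ⊇ Λ_f` a lattice with `(g₂(Λ), g₃(Λ)) = (−4a₄, −4a₆)`, and `(F, G)` a presentation of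
`x = ℘_Λ(u)` by cusp forms on `Γ₀(N)` (`ModularParamXFunction`), so that in the function field
`K_N ⊆ ℂ((q))` we have the coordinates `x = xFn`, `y = ℘_Λ'(u) = yFn` of the analytic modular
parametrisation `τ ↦ (℘_Λ(u), ℘_Λ'(u))` of `E : Y² = X³ + a₄X + a₆` (`X = x`, `Y = y/2`), with
invariant differential `dX/2Y = du` (Cremona 1997, §2.10; Shimura 1971, Thm. 7.14).

We prove the identity that drives Honda's formal-group proof of the Eichler–Shimura congruence
(Honda 1970, §6.2, with the parameter `z = −X/Y` of `E` at `O` in place of Honda's `j(z)⁻¹`):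

* `IsXPresentation.exists_formalLog_subst_eq` — **there is a power series `z(q) ∈ qℂ⟦q⟧` with
  `z·y = −2x` in `ℂ((q))` (i.e. `z = −X/Y`, the `q`-expansion of the local parameter `−x/y` of
  `E` pulled back along the parametrisation) such that `log_E(z(q)) = Σₙ aₙ(f) qⁿ/n`**, where
  `log_E = formalLog` is the formal logarithm of `E` (Silverman AEC IV.4–IV.5, the tree's
  `WeierstrassCurve.formalLog`).

The proof is formal (`formalLog_subst_eq_of_ode`, for abstract series `a, b, e ∈ ℂ⟦q⟧`): from the
cleared Weierstrass equation `(bθa − aθb)² = e²b(4a³ − g₂ab² − g₃b³)` of the presentation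
(`odePS_eq_zero`: `θ = q d/dq`, `a, b, e` the expansions of `F, G, f`) and `ord a < ord b`
(`qOrder_lt`) one gets `ord b = ord a + 2 ord e`; the series `z` with `z·(bθa − aθb) = −2abe` has
`ord z = ord e ≥ 1`; the pole-cleared coordinate `X_E(z) = z²x(z) ∈ ℂ⟦z⟧` of the formal group
(`formalXMulSq`, with `X_E² = X_E³ + a₄z⁴X_E + a₆z⁶`, `formalXMulSq_sq_eq`) satisfies
`b·X_E(z(q)) = z(q)²·a` (both sides solve `T² = T³ + a₄z⁴T + a₆z⁶`, `T(0) = 1`, whose solution is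
unique); and `ω_E·(−2X_E) = zX_E' − 2X_E` (`formalYTilde_mul_formalInvDiff`: `dx/ω = 2y`) then
gives `θ(log_E(z)) = ω_E(z)·θz = e = θ(Σ aₙqⁿ/n)`, whence the claim (`log_E(0) = 0`).

## References

* T. Honda, *On the theory of commutative formal groups*, J. Math. Soc. Japan 22 (1970),
  §6.2, pp. 241–242 (`g = f∘φ`, `φ(q)` the `q`-expansion of a local parameter at the origin,
  `df(φ(x)) = Σ aₘ x^{m−1} dx`). [Honda1970]
* J. E. Cremona, *Algorithms for modular elliptic curves*, 2nd ed. (1997), §2.10 (`x = ℘(u)`,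
  `y = ℘'(u)`, `dx/y = du = 2πi f dτ`). [CremonaAlgorithms1997]
* J. H. Silverman, *The Arithmetic of Elliptic Curves*, 2nd ed. (2009), IV.1, IV.4–IV.5
  (`z = −x/y`, `ω(z)`, `log`). [SilvermanAEC2009]
-/

noncomputable section

open Complex Filter Topology Set Function PowerSeries
open UpperHalfPlane hiding I
open scoped Real Topology Manifold MatrixGroups PeriodPair ModularForm WithZero
open ModularForm CongruenceSubgroup

open Literature.NumberTheory.EllipticCurves

namespace Literature.NumberTheory.EllipticCurves.ModularForms

/-! ### `θ = q d/dq`: further identities -/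

section Theta

/-- `θ = X · d/dX` on `ℂ⟦X⟧`. [folklore] -/
theorem thetaPS_eq_X_mul_derivative (F : ℂ⟦X⟧) : thetaPS F = PowerSeries.X * d⁄dX ℂ F := by
  ext n
  rw [coeff_thetaPS]
  rcases n with _ | n
  · simp
  · rw [coeff_succ_X_mul, coeff_derivative]
    push_cast
    ring

/-- `θ(Xᵐ) = m·Xᵐ`. [folklore] -/
theorem thetaPS_X_pow (m : ℕ) : thetaPS ((PowerSeries.X : ℂ⟦X⟧) ^ m) = (m : ℂ⟦X⟧) * PowerSeries.X ^ m := by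
  ext n
  rw [coeff_thetaPS, coeff_X_pow, ← map_natCast (C (R := ℂ)) m, coeff_C_mul, coeff_X_pow]
  split_ifs with h <;> simp [h]

/-- `θ(Xᵐ·A) = m·Xᵐ·A + Xᵐ·θA`. [folklore] -/
theorem thetaPS_X_pow_mul (m : ℕ) (A : ℂ⟦X⟧) :
    thetaPS (PowerSeries.X ^ m * A) = (m : ℂ⟦X⟧) * PowerSeries.X ^ m * A + PowerSeries.X ^ m * thetaPS A := by
  rw [thetaPS_mul, thetaPS_X_pow]

/-- `θ` of a constant multiple. [folklore] -/
theorem thetaPS_C_mul (c : ℂ) (A : ℂ⟦X⟧) : thetaPS (C c * A) = C c * thetaPS A := by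
  ext n; simp [coeff_thetaPS, mul_left_comm]

/-- `θ` kills constants. [folklore] -/
theorem thetaPS_C (c : ℂ) : thetaPS (C c : ℂ⟦X⟧) = 0 := by
  ext n
  rw [coeff_thetaPS, coeff_C, map_zero]
  split_ifs with h
  · rw [h, Nat.cast_zero, zero_mul]
  · rw [mul_zero]

/-- `(θA)(0) = 0`. [folklore] -/
@[simp] theorem constantCoeff_thetaPS (A : ℂ⟦X⟧) : constantCoeff (thetaPS A) = 0 := by
  rw [← coeff_zero_eq_constantCoeff_apply, coeff_thetaPS, Nat.cast_zero, zero_mul]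

/-- `θ(A²) = 2AθA`. [folklore] -/
theorem thetaPS_sq (A : ℂ⟦X⟧) : thetaPS (A ^ 2) = 2 * A * thetaPS A := by
  rw [pow_two, thetaPS_mul]; ring

/-- **Chain rule for `θ`**: `θ(F(z)) = F'(z)·θz` for `z(0) = 0`. [folklore] -/
theorem thetaPS_subst (F : ℂ⟦X⟧) {z : ℂ⟦X⟧} (hz : constantCoeff z = 0) :
    thetaPS (F.subst z) = (d⁄dX ℂ F).subst z * thetaPS z := by
  rw [thetaPS_eq_X_mul_derivative, thetaPS_eq_X_mul_derivative,
    derivative_subst ℂ (HasSubst.of_constantCoeff_zero' hz)]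
  ring

/-- A series with `θF = 0` and `F(0) = 0` vanishes (characteristic zero). [folklore] -/
theorem eq_zero_of_thetaPS_eq_zero {F : ℂ⟦X⟧} (h : thetaPS F = 0) (h0 : constantCoeff F = 0) :
    F = 0 := by
  ext n
  rcases n with _ | n
  · simpa using h0
  · have := PowerSeries.ext_iff.mp h (n + 1)
    rw [coeff_thetaPS, map_zero, mul_eq_zero] at this
    rcases this with h1 | h1
    · exact absurd h1 (by exact_mod_cast Nat.succ_ne_zero n)
    · simpa using h1

/-- **`θ(Σ eₙqⁿ/n) = e`** for `e(0) = 0`. [folklore] -/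
theorem thetaPS_mk_div (e : ℂ⟦X⟧) (he0 : constantCoeff e = 0) :
    thetaPS (PowerSeries.mk fun n ↦ coeff n e / n) = e := by
  ext n
  rw [coeff_thetaPS, coeff_mk]
  rcases n with _ | n
  · rw [Nat.cast_zero, zero_mul, coeff_zero_eq_constantCoeff_apply, he0]
  · have : ((n + 1 : ℕ) : ℂ) ≠ 0 := by exact_mod_cast Nat.succ_ne_zero n
    field_simp

end Theta

/-! ### Substitution helpers over `ℂ` -/

section SubstHelpers

/-- `(C c · F)(z) = C c · F(z)`. [folklore] -/
theorem subst_C_mul_complex {z : ℂ⟦X⟧} (hz : HasSubst z) (c : ℂ) (F : ℂ⟦X⟧) :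
    (C c * F).subst z = C c * F.subst z := by
  rw [← smul_eq_C_mul, subst_smul hz, smul_eq_C_mul]

/-- `(X^k · F)(z) = z^k · F(z)`. [folklore] -/
theorem subst_X_pow_mul {z : ℂ⟦X⟧} (hz : HasSubst z) (k : ℕ) (F : ℂ⟦X⟧) :
    (PowerSeries.X ^ k * F).subst z = z ^ k * F.subst z := by
  rw [subst_mul hz, subst_pow hz, subst_X hz]

/-- Constants are unchanged by substitution. [folklore] -/
theorem subst_C' {z : ℂ⟦X⟧} (hz : HasSubst z) (c : ℂ) : (C c : ℂ⟦X⟧).subst z = C c := by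
  rw [← mul_one (C c), subst_C_mul_complex hz, ← coe_substAlgHom hz, map_one]

/-- `F(z)(0) = F(0)` when `z(0) = 0`. [folklore] -/
theorem constantCoeff_subst_of_zero {z : ℂ⟦X⟧} (hz : constantCoeff z = 0) (F : ℂ⟦X⟧) :
    constantCoeff (F.subst z) = constantCoeff F := by
  rw [← coeff_zero_eq_constantCoeff_apply, coeff_subst' (HasSubst.of_constantCoeff_zero' hz),
    finsum_eq_single _ 0]
  · simp
  · intro d hd
    rw [coeff_zero_eq_constantCoeff_apply, map_pow, hz, zero_pow hd, smul_zero]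

end SubstHelpers

/-! ### Elementary facts on orders in `ℂ⟦q⟧` -/

section Orders

/-- Comparing `Xⁱ·u = Xʲ·v` for `u(0), v(0) ≠ 0`: the exponents agree. [folklore] -/
theorem eq_of_X_pow_mul_eq_X_pow_mul {i j : ℕ} {u v : ℂ⟦X⟧} (hu : constantCoeff u ≠ 0)
    (hv : constantCoeff v ≠ 0) (h : PowerSeries.X ^ i * u = PowerSeries.X ^ j * v) : i = j := by
  have hou : u.order = 0 := order_zero_of_unit ((isUnit_iff_constantCoeff).mpr (isUnit_iff_ne_zero.mpr hu))
  have hov : v.order = 0 := order_zero_of_unit ((isUnit_iff_constantCoeff).mpr (isUnit_iff_ne_zero.mpr hv))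
  have h1 : (PowerSeries.X ^ i * u).order = (i : ℕ∞) := by rw [order_mul, order_X_pow, hou, add_zero]
  have h2 : (PowerSeries.X ^ j * v).order = (j : ℕ∞) := by rw [order_mul, order_X_pow, hov, add_zero]
  rw [h, h2] at h1
  exact_mod_cast h1.symm

/-- … and then the unit parts agree. [folklore] -/
theorem eq_of_X_pow_mul_eq_X_pow_mul' {i j : ℕ} {u v : ℂ⟦X⟧} (hu : constantCoeff u ≠ 0)
    (hv : constantCoeff v ≠ 0) (h : PowerSeries.X ^ i * u = PowerSeries.X ^ j * v) : u = v := by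
  have hij := eq_of_X_pow_mul_eq_X_pow_mul hu hv h
  subst hij
  exact X_pow_mul_cancel h

/-- A nonzero series is `X^{ord}` times a series with nonzero constant term. [folklore] -/
theorem exists_eq_X_pow_mul {a : ℂ⟦X⟧} (ha : a ≠ 0) :
    ∃ A : ℂ⟦X⟧, constantCoeff A ≠ 0 ∧ a = PowerSeries.X ^ a.order.toNat * A :=
  ⟨divXPowOrder a, fun h ↦ ha (constantCoeff_divXPowOrder_eq_zero_iff.mp h),
    X_pow_order_mul_divXPowOrder.symm⟩

/-- `a(0) = 0` and `a ≠ 0` give `ord a ≥ 1`. [folklore] -/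
theorem one_le_order_toNat {a : ℂ⟦X⟧} (ha : a ≠ 0) (ha0 : constantCoeff a = 0) :
    1 ≤ a.order.toNat := by
  have h1 : (1 : ℕ∞) ≤ a.order := one_le_order_iff_constCoeff_eq_zero.mpr ha0
  have h2 : a.order = (a.order.toNat : ℕ∞) := (coe_toNat_order ha).symm
  rw [h2] at h1
  exact_mod_cast h1

end Orders

/-! ### Uniqueness for `T² = T³ + a₄z⁴T + a₆z⁶`, `T(0) = 1` -/

section Unique

/-- **The pole-cleared Weierstrass equation has a unique solution with `T(0) = 1`**: if
`Tᵢ² = Tᵢ³ + a₄z⁴Tᵢ + a₆z⁶` (`i = 1, 2`) in `ℂ⟦q⟧` with `z(0) = 0` and `T₁(0) = T₂(0) = 1`, then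
`T₁ = T₂` (the difference times `(T₁ + T₂) − (T₁² + T₁T₂ + T₂²) − a₄z⁴`, a series with
constant term `−1`, vanishes). [folklore] -/
theorem eq_of_sq_eq_cube (a₄ a₆ : ℂ) {z T₁ T₂ : ℂ⟦X⟧} (hz : constantCoeff z = 0)
    (h1 : constantCoeff T₁ = 1) (h2 : constantCoeff T₂ = 1)
    (e1 : T₁ ^ 2 = T₁ ^ 3 + C a₄ * z ^ 4 * T₁ + C a₆ * z ^ 6)
    (e2 : T₂ ^ 2 = T₂ ^ 3 + C a₄ * z ^ 4 * T₂ + C a₆ * z ^ 6) : T₁ = T₂ := by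
  have key : (T₁ - T₂) * (T₁ + T₂ - (T₁ ^ 2 + T₁ * T₂ + T₂ ^ 2) - C a₄ * z ^ 4) = 0 := by
    linear_combination e1 - e2
  have hM : T₁ + T₂ - (T₁ ^ 2 + T₁ * T₂ + T₂ ^ 2) - C a₄ * z ^ 4 ≠ 0 := by
    intro h0
    have := congrArg constantCoeff h0
    simp [h1, h2, hz] at this
  exact sub_eq_zero.mp ((mul_eq_zero.mp key).resolve_right hM)

end Unique

/-! ### The core identity: `log_E(z) = Σ eₙqⁿ/n` from the cleared Weierstrass equation -/

section Core

/-- **`log_E(z(q)) = Σ eₙ qⁿ/n`, formal version.** Let `a, b, e ∈ ℂ⟦q⟧` be nonzero with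
`a(0) = e(0) = 0`, `ord a < ord b`, satisfying the cleared Weierstrass equation
`(bθa − aθb)² = 4e²b(a³ + a₄ab² + a₆b³)` (`θ = q d/dq`; this is `θ(x)² = e²(4x³ − g₂x − g₃)` for
`x = a/b`, `g₂ = −4a₄`, `g₃ = −4a₆`), and let `z ∈ ℂ⟦q⟧` with `z·(bθa − aθb) = −2abe` (i.e.
`z = −2x/y = −X/Y` for `y = θx/e`, `Y = y/2`: the local parameter `−X/Y` of
`E : Y² = X³ + a₄X + a₆` at `O`). Then `z(0) = 0` and the formal logarithm of `E` satisfies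
`log_E(z) = Σₙ eₙqⁿ/n`. (Honda 1970, §6.2: "`df(φ(x)) = Σ aₘx^{m−1}dx`" for the expansion `φ`
of a local parameter at the origin; here derived from `dx/2Y = du`.)
[cite: Honda1970, §6.2 (pp. 241–242)] [cite: CremonaAlgorithms1997, §2.10] -/
theorem formalLog_subst_eq_of_ode (a₄ a₆ : ℂ) {a b e z : ℂ⟦X⟧} (ha : a ≠ 0) (hb : b ≠ 0)
    (he : e ≠ 0) (ha0 : constantCoeff a = 0) (he0 : constantCoeff e = 0)
    (hord : a.order.toNat < b.order.toNat)
    (hode : (b * thetaPS a - a * thetaPS b) ^ 2 =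
      4 * e ^ 2 * b * (a ^ 3 + C a₄ * a * b ^ 2 + C a₆ * b ^ 3))
    (hz : z * (b * thetaPS a - a * thetaPS b) = -2 * a * b * e) :
    constantCoeff z = 0 ∧
      ({ a₁ := 0, a₂ := 0, a₃ := 0, a₄ := a₄, a₆ := a₆ } : WeierstrassCurve ℂ).formalLog.subst z =
        PowerSeries.mk fun n ↦ coeff n e / n := by
  set W : WeierstrassCurve ℂ := { a₁ := 0, a₂ := 0, a₃ := 0, a₄ := a₄, a₆ := a₆ } with hW
  -- Step 0: factor out the orders
  obtain ⟨A, hA0, haA⟩ := exists_eq_X_pow_mul ha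
  obtain ⟨B, hB0, hbB⟩ := exists_eq_X_pow_mul hb
  obtain ⟨E, hE0, heE⟩ := exists_eq_X_pow_mul he
  set ma := a.order.toNat with hma
  set mb := b.order.toNat with hmb
  set me := e.order.toNat with hme
  have hma1 : 1 ≤ ma := one_le_order_toNat ha ha0
  have hme1 : 1 ≤ me := one_le_order_toNat he he0
  obtain ⟨d, hd⟩ : ∃ d, mb = ma + d + 1 := Nat.exists_eq_add_of_lt hord
  -- `θa = X^{ma}(ma A + θA)` etc., and `D = X^{ma+mb} D̃`
  set Dt := B * ((ma : ℂ⟦X⟧) * A + thetaPS A) - A * ((mb : ℂ⟦X⟧) * B + thetaPS B) with hDt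
  clear_value Dt
  have hD : b * thetaPS a - a * thetaPS b = PowerSeries.X ^ (ma + mb) * Dt := by
    rw [haA, hbB, thetaPS_X_pow_mul, thetaPS_X_pow_mul, hDt]; ring
  have hDt0 : constantCoeff Dt ≠ 0 := by
    have hne : (ma : ℂ) ≠ mb := by
      intro h; have := (Nat.cast_injective h : ma = mb); omega
    rw [hDt]
    simp only [map_sub, map_mul, map_add, map_natCast, constantCoeff_thetaPS, add_zero]
    intro h
    apply hne
    have h' : ((ma : ℂ) - mb) * (constantCoeff A * constantCoeff B) = 0 := by
      linear_combination h
    rcases mul_eq_zero.mp h' with h1 | h1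
    · exact (sub_eq_zero.mp h1)
    · exact absurd h1 (mul_ne_zero hA0 hB0)
  -- Step 1: the ODE compares `X^{2ma+2mb} D̃²` with `X^{2me+mb+3ma}·4E²B·C̃`
  set Ct := A ^ 3 + C a₄ * PowerSeries.X ^ (2 * (d + 1)) * A * B ^ 2 +
    C a₆ * PowerSeries.X ^ (3 * (d + 1)) * B ^ 3 with hCt
  clear_value Ct
  have hCt0 : constantCoeff Ct ≠ 0 := by
    rw [hCt]
    simp only [map_add, map_mul, map_pow, constantCoeff_C, constantCoeff_X, ne_eq]
    rw [zero_pow (by omega), zero_pow (by omega)]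
    simpa using pow_ne_zero 3 hA0
  have hcubic : a ^ 3 + C a₄ * a * b ^ 2 + C a₆ * b ^ 3 = PowerSeries.X ^ (3 * ma) * Ct := by
    rw [haA, hbB, hCt, hd]; ring
  have hode' : PowerSeries.X ^ (2 * (ma + mb)) * Dt ^ 2 =
      PowerSeries.X ^ (2 * me + mb + 3 * ma) * (4 * E ^ 2 * B * Ct) := by
    have := hode
    rw [hD, hcubic, heE, hbB] at this
    linear_combination this
  have hunits1 : constantCoeff (Dt ^ 2) ≠ 0 := by rw [map_pow]; exact pow_ne_zero 2 hDt0
  have hunits2 : constantCoeff (4 * E ^ 2 * B * Ct) ≠ 0 := by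
    simp only [map_mul, map_pow, map_ofNat]
    exact mul_ne_zero (mul_ne_zero (mul_ne_zero (by norm_num) (pow_ne_zero 2 hE0)) hB0) hCt0
  have hexp : 2 * (ma + mb) = 2 * me + mb + 3 * ma := eq_of_X_pow_mul_eq_X_pow_mul hunits1 hunits2 hode'
  have hDt2 : Dt ^ 2 = 4 * E ^ 2 * B * Ct := eq_of_X_pow_mul_eq_X_pow_mul' hunits1 hunits2 hode'
  -- hence `mb = ma + 2me`, i.e. `d + 1 = 2 me`
  have hd2 : d + 1 = 2 * me := by omega
  -- Step 2: `z = X^{me} Z̃` with `Z̃ D̃ = −2ABE`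
  set Zt := -2 * A * B * E * Dt⁻¹ with hZt
  clear_value Zt
  have hZD : Zt * Dt = -2 * A * B * E := by
    rw [hZt, mul_assoc, PowerSeries.inv_mul_cancel _ hDt0, mul_one]
  have hzZ : z = PowerSeries.X ^ me * Zt := by
    have h1 : PowerSeries.X ^ (ma + mb) * (z * Dt) =
        PowerSeries.X ^ (ma + mb) * (PowerSeries.X ^ me * Zt * Dt) := by
      have := hz
      rw [hD, haA, hbB, heE] at this
      linear_combination this - PowerSeries.X ^ (ma + mb) * PowerSeries.X ^ me * hZD
    have h2 : z * Dt = PowerSeries.X ^ me * Zt * Dt := X_pow_mul_cancel h1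
    have hDtne : Dt ≠ 0 := fun h ↦ hDt0 (by rw [h, map_zero])
    exact mul_right_cancel₀ hDtne h2
  have hz0 : constantCoeff z = 0 := by
    rw [hzZ, map_mul, map_pow, constantCoeff_X, zero_pow (by omega), zero_mul]
  refine ⟨hz0, ?_⟩
  have hzs : HasSubst z := HasSubst.of_constantCoeff_zero' hz0
  -- Step 3: the `(QC)` relation `Z̃² C̃ = A² B`
  have hQC : Zt ^ 2 * Ct = A ^ 2 * B := by
    have hEBC : 4 * E ^ 2 * B * Ct ≠ 0 := fun h ↦ hunits2 (by rw [h, map_zero])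
    have key : (Zt ^ 2 * Ct - A ^ 2 * B) * (4 * E ^ 2 * B * Ct) = 0 := by
      linear_combination (-Ct * Zt ^ 2) * hDt2 + Ct * (Zt * Dt - 2 * A * B * E) * hZD
    exact sub_eq_zero.mp ((mul_eq_zero.mp key).resolve_right hEBC)
  -- Step 4: `b·X_E(z) = z²·a`
  set P := W.formalXMulSq.subst z with hP
  clear_value P
  have hP0 : constantCoeff P = 1 := by
    rw [hP, constantCoeff_subst_of_zero hz0, WeierstrassCurve.constantCoeff_formalXMulSq]
  have hPeq : P ^ 2 = P ^ 3 + C a₄ * z ^ 4 * P + C a₆ * z ^ 6 := by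
    have h := W.formalXMulSq_sq_eq
    have h1 : W.a₁ = 0 := rfl
    have h2 : W.a₂ = 0 := rfl
    have h3 : W.a₃ = 0 := rfl
    have h4 : W.a₄ = a₄ := rfl
    have h6 : W.a₆ = a₆ := rfl
    rw [h1, h2, h3, h4, h6, map_zero] at h
    simp only [zero_mul, add_zero] at h
    have h' := congrArg (PowerSeries.subst z) h
    simp only [subst_pow hzs, subst_add hzs, subst_mul hzs, subst_X hzs, subst_C' hzs] at h'
    rw [hP]
    linear_combination h'
  set Q := Zt ^ 2 * A * B⁻¹ with hQ
  clear_value Q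
  have hBinv : B * B⁻¹ = 1 := PowerSeries.mul_inv_cancel _ hB0
  have hBQ : B * Q = Zt ^ 2 * A := by
    rw [hQ]; linear_combination Zt ^ 2 * A * hBinv
  have hQ0 : constantCoeff Q = 1 := by
    have hγ : constantCoeff Ct = constantCoeff A ^ 3 := by
      rw [hCt]
      simp only [map_add, map_mul, map_pow, constantCoeff_C, constantCoeff_X]
      rw [zero_pow (by omega), zero_pow (by omega)]
      ring
    have h1 := congrArg constantCoeff hBQ
    have h2 := congrArg constantCoeff hQC
    simp only [map_mul, map_pow] at h1 h2
    rw [hγ] at h2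
    -- `h2 : ζ² α³ = α² β`, `h1 : β·Q(0) = ζ² α`
    have h3 : constantCoeff Zt ^ 2 * constantCoeff A = constantCoeff B := by
      have : (constantCoeff Zt ^ 2 * constantCoeff A - constantCoeff B) * constantCoeff A ^ 2 = 0 := by
        linear_combination h2
      exact sub_eq_zero.mp ((mul_eq_zero.mp this).resolve_right (pow_ne_zero 2 hA0))
    rw [h3] at h1
    refine mul_left_cancel₀ hB0 ?_
    rw [mul_one]
    exact h1
  have hQeq : Q ^ 2 = Q ^ 3 + C a₄ * z ^ 4 * Q + C a₆ * z ^ 6 := by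
    have hB3 : B ^ 3 ≠ 0 := pow_ne_zero 3 (fun h ↦ hB0 (by rw [h, map_zero]))
    have key : B ^ 3 * (Q ^ 2 - (Q ^ 3 + C a₄ * z ^ 4 * Q + C a₆ * z ^ 6)) = 0 := by
      rw [hzZ]
      have hCt' : Ct = A ^ 3 + C a₄ * PowerSeries.X ^ (4 * me) * A * B ^ 2 +
          C a₆ * PowerSeries.X ^ (6 * me) * B ^ 3 := by
        rw [hCt, hd2]; ring_nf
      linear_combination (B * (B * Q + Zt ^ 2 * A) - ((B * Q) ^ 2 + B * Q * Zt ^ 2 * A + Zt ^ 4 * A ^ 2) -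
        C a₄ * (PowerSeries.X ^ me * Zt) ^ 4 * B ^ 2) * hBQ - Zt ^ 4 * hQC + Zt ^ 6 * hCt'
    exact sub_eq_zero.mp ((mul_eq_zero.mp key).resolve_left hB3)
  have hPQ : P = Q := eq_of_sq_eq_cube a₄ a₆ hz0 hP0 hQ0 hPeq hQeq
  have hF3 : b * P = z ^ 2 * a := by
    have hmb2 : mb = ma + 2 * me := by omega
    rw [hPQ, hbB, hzZ, haA, hmb2, mul_assoc, hBQ]; ring
  -- Step 5: `ω_E(z)·θz = e`
  set Ω := W.formalOmega.subst z * thetaPS z with hΩ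
  clear_value Ω
  have hF1 : PowerSeries.X * d⁄dX ℂ W.formalXMulSq =
      C (2 : ℂ) * (W.formalXMulSq - W.formalXMulSq * W.formalOmega) := by
    have h := W.formalYTilde_mul_formalInvDiff
    have h1 : W.a₁ = 0 := rfl
    have h3 : W.a₃ = 0 := rfl
    rw [W.formalYTilde_def, h1, h3, map_zero, W.formalInvDiff_eq_formalOmega] at h
    have h2 : (C (2 : ℂ) : ℂ⟦X⟧) = 2 := map_ofNat C 2
    rw [h2]
    linear_combination -h
  have hF2 : -2 * P * Ω = z * thetaPS P - 2 * P * thetaPS z := by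
    have h' := congrArg (PowerSeries.subst z) hF1
    rw [subst_mul hzs, subst_X hzs, subst_C_mul_complex hzs, subst_sub hzs, subst_mul hzs] at h'
    have h2 : (C (2 : ℂ) : ℂ⟦X⟧) = 2 := map_ofNat C 2
    rw [h2] at h'
    rw [hP, hΩ, thetaPS_subst _ hz0]
    linear_combination (-thetaPS z) * h'
  -- `θ` of Step 4
  have hF3' : thetaPS b * P + b * thetaPS P = 2 * z * thetaPS z * a + z ^ 2 * thetaPS a := by
    have := congrArg thetaPS hF3
    rw [thetaPS_mul, thetaPS_mul, thetaPS_sq] at this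
    linear_combination this
  -- combine: `z²·(2abΩ + z(bθa − aθb)) = 0`
  have hG : z ^ 2 * (2 * a * b * Ω + z * (b * thetaPS a - a * thetaPS b)) = 0 := by
    linear_combination (-b ^ 2) * hF2 + (2 * b * thetaPS z + z * thetaPS b - 2 * b * Ω) * hF3 -
      (z * b) * hF3'
  have htwo : (2 : ℂ⟦X⟧) ≠ 0 := by
    intro h
    have := congrArg constantCoeff h
    rw [map_ofNat, map_zero] at this
    norm_num at this
  have hzne : z ≠ 0 := by
    rintro rfl
    rw [zero_mul] at hz
    have : (-2 : ℂ⟦X⟧) * a * b * e ≠ 0 :=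
      mul_ne_zero (mul_ne_zero (mul_ne_zero (neg_ne_zero.mpr htwo) ha) hb) he
    exact this hz.symm
  have hG' : 2 * a * b * Ω + z * (b * thetaPS a - a * thetaPS b) = 0 :=
    (mul_eq_zero.mp hG).resolve_left (pow_ne_zero 2 hzne)
  have hΩe : Ω = e := by
    have h2ab : (2 : ℂ⟦X⟧) * a * b ≠ 0 := mul_ne_zero (mul_ne_zero htwo ha) hb
    have : 2 * a * b * (Ω - e) = 0 := by linear_combination hG' - hz
    exact sub_eq_zero.mp ((mul_eq_zero.mp this).resolve_left h2ab)
  -- Step 6: `θ(log_E(z)) = e = θ(Σ eₙqⁿ/n)` and both vanish at `0`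
  have hθ : thetaPS (W.formalLog.subst z - PowerSeries.mk fun n ↦ coeff n e / n) = 0 := by
    rw [thetaPS_sub, thetaPS_subst _ hz0, W.derivative_formalLog, thetaPS_mk_div e he0, ← hΩ, hΩe,
      sub_self]
  have h0 : constantCoeff (W.formalLog.subst z - PowerSeries.mk fun n ↦ coeff n e / n) = 0 := by
    rw [map_sub, constantCoeff_subst_of_zero hz0, W.constantCoeff_formalLog,
      ← coeff_zero_eq_constantCoeff_apply, coeff_mk]
    simp
  exact sub_eq_zero.mp (eq_zero_of_thetaPS_eq_zero hθ h0)

end Core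

/-! ### Existence of `z` and the modular wrapper -/

section Modular

/-- **The series `z = −2abe/(bθa − aθb)` exists in `ℂ⟦q⟧`** as soon as `a, b ≠ 0` have different
orders (then `ord(bθa − aθb) = ord a + ord b ≤ ord(abe)`). [folklore] -/
theorem exists_mul_wronskian_eq {a b : ℂ⟦X⟧} (e : ℂ⟦X⟧) (ha : a ≠ 0) (hb : b ≠ 0)
    (hord : a.order.toNat < b.order.toNat) :
    ∃ z : ℂ⟦X⟧, z * (b * thetaPS a - a * thetaPS b) = -2 * a * b * e := by
  obtain ⟨A, hA0, haA⟩ := exists_eq_X_pow_mul ha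
  obtain ⟨B, hB0, hbB⟩ := exists_eq_X_pow_mul hb
  set ma := a.order.toNat with hma
  set mb := b.order.toNat with hmb
  set Dt := B * ((ma : ℂ⟦X⟧) * A + thetaPS A) - A * ((mb : ℂ⟦X⟧) * B + thetaPS B) with hDt
  clear_value Dt
  have hD : b * thetaPS a - a * thetaPS b = PowerSeries.X ^ (ma + mb) * Dt := by
    rw [haA, hbB, thetaPS_X_pow_mul, thetaPS_X_pow_mul, hDt]; ring
  have hDt0 : constantCoeff Dt ≠ 0 := by
    have hne : (ma : ℂ) ≠ mb := by
      intro h; have := (Nat.cast_injective h : ma = mb); omega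
    rw [hDt]
    simp only [map_sub, map_mul, map_add, map_natCast, constantCoeff_thetaPS, add_zero]
    intro h
    apply hne
    have h' : ((ma : ℂ) - mb) * (constantCoeff A * constantCoeff B) = 0 := by
      linear_combination h
    rcases mul_eq_zero.mp h' with h1 | h1
    · exact (sub_eq_zero.mp h1)
    · exact absurd h1 (mul_ne_zero hA0 hB0)
  refine ⟨-2 * A * B * e * Dt⁻¹, ?_⟩
  rw [hD, haA, hbB]
  have hinv : Dt⁻¹ * Dt = 1 := PowerSeries.inv_mul_cancel _ hDt0
  linear_combination (-2 * A * B * e * PowerSeries.X ^ (ma + mb)) * hinv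

variable {N : ℕ} [NeZero N] {k : ℤ}

namespace IsXPresentation

variable {f : CuspForm (Gamma0 N) 2} {L : PeriodPair} {F G : CuspForm (Gamma0 N) k}

/-- **`log_E(z(q)) = Σₙ aₙ(f)qⁿ/n` along the modular parametrisation.** Let `f ∈ S₂(Γ₀(N))` be
nonzero, `Λ(L) ⊇ Λ_f` with `g₂(L) = −4a₄`, `g₃(L) = −4a₆`, and `(F, G)` a presentation of
`x = ℘_Λ(2πi∫f)` by cusp forms (`IsXPresentation`), giving `x = xFn`, `y = ℘_Λ'(2πi∫f) = yFn`
in `K_N ⊆ ℂ((q))`. Then there is `z ∈ qℂ⟦q⟧` with `z·y = −2x` in `ℂ((q))` — the `q`-expansion of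
the local parameter `z = −X/Y` of `E : Y² = X³ + a₄X + a₆` (`X = x`, `Y = y/2`) at `O` along
`τ ↦ (X(τ), Y(τ))` — such that the formal logarithm of `E` satisfies
`log_E(z) = Σₙ aₙ(f) qⁿ/n = 2πi∫_{i∞} f` (as `q`-series; Cremona 1997, (2.10.3)). This is the
identity `g = f∘φ` of Honda 1970, §6.2 ("`df(φ(x)) = Σ aₘx^{m−1}dx`"), here obtained from
`dX/2Y = du` without any model of `X₀(N)`. [cite: Honda1970, §6.2 (pp. 241–242)]
[cite: CremonaAlgorithms1997, §2.10] -/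
theorem exists_formalLog_subst_eq (h : IsXPresentation f L F G) (hf : f ≠ 0) {a₄ a₆ : ℂ}
    (h₂ : L.g₂ = -4 * a₄) (h₃ : L.g₃ = -4 * a₆) :
    ∃ z : ℂ⟦X⟧, constantCoeff z = 0 ∧
      (z : LaurentSeries ℂ) * ((h.yFn hf : modularFunctionField N) : LaurentSeries ℂ) =
        -2 * ((h.xFn : modularFunctionField N) : LaurentSeries ℂ) ∧
      ({ a₁ := 0, a₂ := 0, a₃ := 0, a₄ := a₄, a₆ := a₆ } : WeierstrassCurve ℂ).formalLog.subst z =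
        PowerSeries.mk fun n ↦ cuspCoeff f n / n := by
  set a := qExpansion 1 (⇑F) with ha
  set b := qExpansion 1 (⇑G) with hb
  set e := qExpansion 1 (⇑f) with he
  have hF0 : (F : ModularForm (Gamma0 N) k) ≠ 0 := h.numerator_ne_zero hf
  have hG0 := h.modularForm_ne_zero
  have hf' : (f : ModularForm (Gamma0 N) 2) ≠ 0 := by
    intro h0; apply hf; apply DFunLike.ext; intro τ; exact DFunLike.congr_fun h0 τ
  have ha0 : a ≠ 0 := qExpansion_ne_zero_of_ne_zero hF0
  have hb0 : b ≠ 0 := qExpansion_ne_zero_of_ne_zero hG0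
  have he0 : e ≠ 0 := qExpansion_ne_zero_of_ne_zero hf'
  have hac : constantCoeff a = 0 := by
    rw [← coeff_zero_eq_constantCoeff_apply, ha]
    exact CuspFormClass.qExpansion_coeff_zero F one_pos (one_mem_strictPeriods_coe_gamma0 N)
  have hec : constantCoeff e = 0 := by
    rw [← coeff_zero_eq_constantCoeff_apply, he]
    exact CuspFormClass.qExpansion_coeff_zero f one_pos (one_mem_strictPeriods_coe_gamma0 N)
  have hord : a.order.toNat < b.order.toNat := h.qOrder_lt hf
  have hode : (b * thetaPS a - a * thetaPS b) ^ 2 =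
      4 * e ^ 2 * b * (a ^ 3 + C a₄ * a * b ^ 2 + C a₆ * b ^ 3) := by
    have h0 := h.odePS_eq_zero hf
    rw [h₂, h₃, map_mul, map_mul, map_neg, map_ofNat] at h0
    rw [← ha, ← hb, ← he] at h0
    linear_combination h0
  obtain ⟨z, hz⟩ := exists_mul_wronskian_eq e ha0 hb0 hord
  obtain ⟨hz0, hlog⟩ := formalLog_subst_eq_of_ode a₄ a₆ ha0 hb0 he0 hac hec hord hode hz
  refine ⟨z, hz0, ?_, ?_⟩
  · -- the Laurent identity `z·y = −2x`
    have hbL : ((b : ℂ⟦X⟧) : LaurentSeries ℂ) ≠ 0 := fun h0 ↦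
      hb0 (HahnSeries.ofPowerSeries_injective (Γ := ℤ) (R := ℂ) (h0.trans (map_zero _).symm))
    have heL : ((e : ℂ⟦X⟧) : LaurentSeries ℂ) ≠ 0 := fun h0 ↦
      he0 (HahnSeries.ofPowerSeries_injective (Γ := ℤ) (R := ℂ) (h0.trans (map_zero _).symm))
    have hD0 : b * thetaPS a - a * thetaPS b ≠ 0 := by
      intro h0
      rw [h0, mul_zero] at hz
      have htwo : (2 : ℂ⟦X⟧) ≠ 0 := by
        intro h
        have := congrArg constantCoeff h
        rw [map_ofNat, map_zero] at this
        norm_num at this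
      exact mul_ne_zero (mul_ne_zero (mul_ne_zero (neg_ne_zero.mpr htwo) ha0) hb0) he0 hz.symm
    have hDL : ((b * thetaPS a - a * thetaPS b : ℂ⟦X⟧) : LaurentSeries ℂ) ≠ 0 := fun h0 ↦
      hD0 (HahnSeries.ofPowerSeries_injective (Γ := ℤ) (R := ℂ) (h0.trans (map_zero _).symm))
    have hzL : ((z : ℂ⟦X⟧) : LaurentSeries ℂ) * ((b * thetaPS a - a * thetaPS b : ℂ⟦X⟧) : LaurentSeries ℂ) =
        -2 * (a : LaurentSeries ℂ) * (b : LaurentSeries ℂ) * (e : LaurentSeries ℂ) := by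
      rw [← PowerSeries.coe_mul, hz]
      simp only [PowerSeries.coe_mul, PowerSeries.coe_neg, map_ofNat]
    have hx : ((h.xFn : modularFunctionField N) : LaurentSeries ℂ) =
        (a : LaurentSeries ℂ) / (b : LaurentSeries ℂ) := rfl
    rw [h.coe_yFn hf, hx, ← ha, ← hb, ← he, PowerSeries.coe_mul, PowerSeries.coe_mul,
      mul_div_assoc']
    rw [div_eq_iff (mul_ne_zero (mul_ne_zero hbL hbL) heL), hzL]
    field_simp
  · rw [hlog]
    rfl

end IsXPresentation

end Modular



end Literature.NumberTheory.EllipticCurves.ModularForms
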